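import Literature.Barriers.AtomisticToContinuum.AnticontinuumLocalizationConfigChain
import Literature.Probability.Distributions.GaussianPiDensity
import Mathlib.Probability.Moments.Variance
import Mathlib.MeasureTheory.Integral.Pi
import Mathlib.Analysis.SpecialFunctions.Gaussian.GaussianIntegral
import HarnessLib

/-!
# The Gibbs state of the rotor chain is a product: angles `⊗` Gaussian momenta

`Literature/Barriers/AtomisticToContinuum/` — support file for the discharge of
`DeRoeckHuveneers2015_decorrelation` (eq. (7.1) of De Roeck–Huveneers 2015). The Gibbs state
`⟨·⟩_T = Z⁻¹ e^{-H/T} dq dω` of the rotor chain (`RotorChain.gibbsMeasure N T ε γ`, carried by the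
fundamental domain `[0,2π)^N × ℝ^N`) is the PRODUCT of the configurational Gibbs measure
`ν_{N,ε/T,γ}` (`RotorChain.configGibbs`) and of the law of `N` i.i.d. centred Gaussian momenta of
variance `T` (Mathlib's `Measure.pi fun _ => gaussianReal 0 T`):

* `gibbsMeasure_eq_prod : gibbsMeasure N T ε γ = (configGibbs N (ε/T) γ).prod (Measure.pi …)`
  (`T > 0`, `ε, γ ≥ 0`): factorisation of the Boltzmann weight, `Measure.prod_restrict`,
  `prod_withDensity`, the product of the partition functions (`partitionFunction_eq_mul`) and
  the identification of the normalised Gaussian density with `Measure.pi gaussianReal`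
  (`Literature.Probability.Distributions.pi_gaussianReal_eq_inv_smul_withDensity`);
* `isProbabilityMeasure_configGibbs`, `integrable_configGibbs_of_continuous` — `ν` is a
  probability measure and continuous observables are `ν`-integrable (`β, γ ≥ 0`);
* `sq_integral_le_integral_sq` — Jensen for squares on a probability space.

All proved; no definitions. [cite: DeRoeckHuveneers2015, §2.2]
-/

noncomputable section

open MeasureTheory ProbabilityTheory Function Set Filter
open scoped ENNReal NNReal

namespace Literature.Barriers.AtomisticToContinuum.HeatConduction.RotorChain

open Literature.MathematicalPhysics.KineticTheory.HeatConduction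
open Literature.Probability.Distributions

variable {N : ℕ}

/-! ### The Gaussian momentum weight -/

/-- The momentum weight `e^{-(∑_x ω_x²/2)/T}` is a product of one-dimensional Gaussians. [folklore] -/
theorem momWeight_eq_prod (T : ℝ) (ω : Fin N → ℝ) :
    Real.exp (-(∑ x, ω x ^ 2 / 2) / T) = ∏ x, Real.exp (-(1 / (2 * T)) * ω x ^ 2) := by
  rw [← Real.exp_sum]
  congr 1
  rw [neg_div, Finset.sum_div, ← Finset.sum_neg_distrib]
  refine Finset.sum_congr rfl fun x _ => ?_
  rcases eq_or_ne T 0 with hT | hT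
  · subst hT; simp
  · field_simp

/-- The momentum weight is integrable (`T > 0`). [folklore] -/
theorem integrable_momWeight {T : ℝ} (hT : 0 < T) :
    Integrable (fun ω : Fin N → ℝ => Real.exp (-(∑ x, ω x ^ 2 / 2) / T)) := by
  simp_rw [momWeight_eq_prod T]
  rw [volume_pi]
  exact Integrable.fintype_prod (f := fun (_ : Fin N) (s : ℝ) => Real.exp (-(1 / (2 * T)) * s ^ 2))
    fun _ => integrable_exp_neg_mul_sq (by positivity)

/-- The momentum partition function `∫ e^{-(∑ω²/2)/T} dω` is positive (`T > 0`). [folklore] -/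
theorem integral_momWeight_pos {T : ℝ} (hT : 0 < T) :
    0 < ∫ ω : Fin N → ℝ, Real.exp (-(∑ x, ω x ^ 2 / 2) / T) := by
  haveI : (volume : Measure (Fin N → ℝ)).IsOpenPosMeasure := by rw [volume_pi]; infer_instance
  refine (integral_pos_iff_support_of_nonneg (fun ω => (Real.exp_pos _).le) (integrable_momWeight hT)).2 ?_
  have hsupp : Function.support (fun ω : Fin N → ℝ => Real.exp (-(∑ x, ω x ^ 2 / 2) / T)) = univ := by
    ext ω; simp [(Real.exp_pos _).ne']
  rw [hsupp]
  exact isOpen_univ.measure_pos volume univ_nonempty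

/-- The total mass of the unnormalised Gaussian density is the momentum partition function. [folklore] -/
theorem withDensity_momWeight_univ {T : ℝ} (hT : 0 < T) :
    (volume : Measure (Fin N → ℝ)).withDensity (fun ω => ENNReal.ofReal (Real.exp (-(∑ x, ω x ^ 2 / 2) / T)))
        univ = ENNReal.ofReal (∫ ω : Fin N → ℝ, Real.exp (-(∑ x, ω x ^ 2 / 2) / T)) := by
  rw [withDensity_apply _ MeasurableSet.univ, Measure.restrict_univ,
    ofReal_integral_eq_lintegral_ofReal (integrable_momWeight hT) (ae_of_all _ fun ω => (Real.exp_pos _).le)]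

/-- **The i.i.d. Gaussian momenta are the normalised momentum weight**:
`⊗ⁿ 𝒩(0, T) = (∫ e^{-(∑ω²/2)/T})⁻¹ · e^{-(∑ω²/2)/T} dω`. [folklore] -/
theorem pi_gaussianReal_eq_momGibbs {T : ℝ} (hT : 0 < T) :
    Measure.pi (fun _ : Fin N => gaussianReal 0 T.toNNReal) =
      (ENNReal.ofReal (∫ ω : Fin N → ℝ, Real.exp (-(∑ x, ω x ^ 2 / 2) / T)))⁻¹ •
        (volume : Measure (Fin N → ℝ)).withDensity
          fun ω => ENNReal.ofReal (Real.exp (-(∑ x, ω x ^ 2 / 2) / T)) := by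
  have hT0 : T.toNNReal ≠ 0 := by
    intro h
    have := Real.toNNReal_eq_zero.1 h
    linarith
  have hcoe : ((T.toNNReal : ℝ≥0) : ℝ) = T := Real.coe_toNNReal T hT.le
  have h := pi_gaussianReal_eq_inv_smul_withDensity N hT0
  rw [hcoe] at h
  rw [h, withDensity_momWeight_univ hT]

/-! ### The product structure of the Gibbs state -/

/-- Volume on the phase space is the product of the volumes. [folklore] -/
theorem volume_phaseSpace_eq_prod (N : ℕ) :
    (volume : Measure (PhaseSpace N)) = (volume : Measure (Fin N → ℝ)).prod (volume : Measure (Fin N → ℝ)) :=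
  rfl

/-- **Factorisation of the unnormalised Gibbs state**:
`(e^{-H/T} dq dω)|_{[0,2π)^N × ℝ^N} = (e^{-(ε/T)∑V_x} dq)|_{[0,2π)^N} ⊗ (e^{-(∑ω²/2)/T} dω)`. [cite: DeRoeckHuveneers2015, §2.2] -/
theorem restrict_domain_withDensity_eq_prod (T ε γ : ℝ) :
    ((volume : Measure (PhaseSpace N)).restrict (domain N)).withDensity
        (fun z => ENNReal.ofReal (gibbsWeight N T ε γ z)) =
      (((volume : Measure (Fin N → ℝ)).restrict (angleBox N)).withDensity
          fun q => ENNReal.ofReal (configWeight N (ε / T) γ q)).prod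
        ((volume : Measure (Fin N → ℝ)).withDensity
          fun ω => ENNReal.ofReal (Real.exp (-(∑ x, ω x ^ 2 / 2) / T))) := by
  rw [prod_withDensity ((continuous_configWeight N (ε / T) γ).measurable.ennreal_ofReal)
    (by fun_prop), Measure.restrict_prod_eq_prod_univ, volume_phaseSpace_eq_prod,
    domain_eq_preimage_angleBox, ← Set.prod_univ]
  congr 1
  funext z
  rw [gibbsWeight_eq_mul_configWeight, ENNReal.ofReal_mul (Real.exp_pos _).le, mul_comm]

/-- **The partition function factorises**: `Z(T) = Z_q(ε/T) · ∫ e^{-(∑ω²/2)/T} dω`. [cite: DeRoeckHuveneers2015, §2.2] -/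
theorem partitionFunction_eq_mul (T ε γ : ℝ) :
    partitionFunction N T ε γ =
      configPartition N (ε / T) γ * ∫ ω : Fin N → ℝ, Real.exp (-(∑ x, ω x ^ 2 / 2) / T) := by
  unfold partitionFunction configPartition
  have h := setIntegral_prod_mul (μ := (volume : Measure (Fin N → ℝ))) (ν := (volume : Measure (Fin N → ℝ)))
    (fun q => configWeight N (ε / T) γ q) (fun ω : Fin N → ℝ => Real.exp (-(∑ x, ω x ^ 2 / 2) / T))
    (angleBox N) univ
  rw [Measure.restrict_univ] at h
  rw [domain_eq_preimage_angleBox, ← Set.prod_univ, volume_phaseSpace_eq_prod, ← h]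
  refine setIntegral_congr_fun ((measurableSet_angleBox N).prod MeasurableSet.univ) fun z _ => ?_
  rw [gibbsWeight_eq_mul_configWeight, mul_comm]

/-- **The Gibbs state is the product of the configurational Gibbs measure and of i.i.d.
`𝒩(0, T)` momenta** (`T > 0`, `ε, γ ≥ 0`):
`⟨·⟩_T = ν_{N,ε/T,γ} ⊗ 𝒩(0, T)^{⊗N}`. [cite: DeRoeckHuveneers2015, §2.2] -/
theorem gibbsMeasure_eq_prod {T ε γ : ℝ} (hT : 0 < T) (hε : 0 ≤ ε) (hγ : 0 ≤ γ) :
    gibbsMeasure N T ε γ =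
      (configGibbs N (ε / T) γ).prod (Measure.pi fun _ : Fin N => gaussianReal 0 T.toNNReal) := by
  have hβ : 0 ≤ ε / T := div_nonneg hε hT.le
  have hZq := configPartition_pos (N := N) hβ hγ
  have hZω := integral_momWeight_pos (N := N) hT
  rw [gibbsMeasure, restrict_domain_withDensity_eq_prod, partitionFunction_eq_mul,
    pi_gaussianReal_eq_momGibbs hT, configGibbs, Measure.prod_smul_left, Measure.prod_smul_right,
    smul_smul, ENNReal.ofReal_mul hZq.le,
    ENNReal.mul_inv (Or.inr ENNReal.ofReal_ne_top) (Or.inl ENNReal.ofReal_ne_top)]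

/-! ### The configurational Gibbs measure: probability, integrability -/

/-- The configurational weight is integrable on the angle box. [folklore] -/
theorem integrableOn_configWeight (N : ℕ) (β γ : ℝ) :
    IntegrableOn (configWeight N β γ) (angleBox N) volume := by
  have h : IntegrableOn (configWeight N β γ) (Set.pi univ fun _ : Fin N => Icc 0 (2 * Real.pi)) volume :=
    (continuous_configWeight N β γ).continuousOn.integrableOn_compact (isCompact_univ_pi fun _ => isCompact_Icc)
  exact h.mono_set (Set.pi_mono fun _ _ => Ico_subset_Icc_self)

/-- **`ν_{N,β,γ}` is a probability measure** (`β, γ ≥ 0`). [cite: DeRoeckHuveneers2015, §2.2] -/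
theorem isProbabilityMeasure_configGibbs {β γ : ℝ} (hβ : 0 ≤ β) (hγ : 0 ≤ γ) :
    IsProbabilityMeasure (configGibbs N β γ) := by
  constructor
  rw [configGibbs, Measure.smul_apply, withDensity_apply _ MeasurableSet.univ, Measure.restrict_univ,
    smul_eq_mul]
  have hZ : ∫⁻ q in angleBox N, ENNReal.ofReal (configWeight N β γ q) = ENNReal.ofReal (configPartition N β γ) := by
    rw [configPartition, ofReal_integral_eq_lintegral_ofReal (integrableOn_configWeight N β γ)
      (ae_of_all _ fun q => (configWeight_pos N β γ q).le)]
  rw [hZ, ENNReal.inv_mul_cancel (ENNReal.ofReal_pos.2 (configPartition_pos hβ hγ)).ne' ENNReal.ofReal_ne_top]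

/-- **Continuous observables of the angles are `ν`-integrable** (`ν` is a finite measure carried
by the bounded box, with a bounded continuous density). [folklore] -/
theorem integrable_configGibbs_of_continuous (β γ : ℝ) {h : (Fin N → ℝ) → ℝ} (hh : Continuous h) :
    Integrable h (configGibbs N β γ) := by
  rw [configGibbs]
  refine Integrable.smul_measure ?_ (ENNReal.inv_ne_top.2 ?_)
  swap
  · exact (ENNReal.ofReal_pos.2 (by
      -- the partition function is positive for all `β, γ`: positive continuous integrand
      haveI : (volume : Measure (Fin N → ℝ)).IsOpenPosMeasure := by rw [volume_pi]; infer_instance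
      rw [configPartition]
      refine (integral_pos_iff_support_of_nonneg (fun q => (configWeight_pos N β γ q).le)
        (integrableOn_configWeight N β γ)).2 ?_
      have hsupp : Function.support (configWeight N β γ) = univ := by
        ext q; simp [(configWeight_pos N β γ q).ne']
      rw [hsupp, Measure.restrict_apply_univ]
      have hsub : (Set.pi univ fun _ : Fin N => Ioo 0 (2 * Real.pi)) ⊆ angleBox N :=
        Set.pi_mono fun _ _ => Ioo_subset_Ico_self
      refine lt_of_lt_of_le ?_ (measure_mono hsub)
      exact (isOpen_set_pi finite_univ fun _ _ => isOpen_Ioo).measure_pos volume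
        ⟨fun _ => Real.pi, fun x _ => ⟨Real.pi_pos, by linarith [Real.pi_pos]⟩⟩)).ne'
  · have e : (fun q : Fin N → ℝ => ENNReal.ofReal (configWeight N β γ q)) =
        fun q => ((configWeight N β γ q).toNNReal : ℝ≥0∞) := rfl
    rw [e, integrable_withDensity_iff_integrable_smul (continuous_configWeight N β γ).measurable.real_toNNReal]
    have e2 : (fun q : Fin N → ℝ => (configWeight N β γ q).toNNReal • h q) =
        fun q => configWeight N β γ q * h q := by
      funext q
      rw [NNReal.smul_def, Real.coe_toNNReal _ (configWeight_pos N β γ q).le, smul_eq_mul]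
    rw [e2]
    have h2 : IntegrableOn (fun q => configWeight N β γ q * h q) (Set.pi univ fun _ : Fin N => Icc 0 (2 * Real.pi)) volume :=
      ((continuous_configWeight N β γ).mul hh).continuousOn.integrableOn_compact
        (isCompact_univ_pi fun _ => isCompact_Icc)
    exact h2.mono_set (Set.pi_mono fun _ _ => Ico_subset_Icc_self)

/-! ### Jensen's inequality for squares -/

/-- **Jensen for squares on a probability space**: `(∫ h)² ≤ ∫ h²` for `h ∈ L²`. [folklore] -/
theorem sq_integral_le_integral_sq {Ω : Type*} [MeasurableSpace Ω] {P : Measure Ω} [IsProbabilityMeasure P]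
    {h : Ω → ℝ} (hh : MemLp h 2 P) : (∫ x, h x ∂P) ^ 2 ≤ ∫ x, h x ^ 2 ∂P := by
  have h1 := variance_nonneg h P
  rw [variance_eq_sub hh] at h1
  simp only [Pi.pow_apply] at h1
  linarith

end Literature.Barriers.AtomisticToContinuum.HeatConduction.RotorChain

end
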